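import Literature.Computability.FineGrained.BKGadget
import Mathlib.Data.Bool.Count
import HarnessLib

/-!
# The Bringmann–Künnemann alignment gadget: the profile of ones of `0^{γ₂} G(xᵢ) 0^{γ₂}` and the
anchoring of short windows (arithmetic of Claim 5.9)

K. Bringmann, M. Künnemann, *Quadratic conditional lower bounds for string problems and dynamic
time warping*, FOCS 2015 (arXiv:1502.01063), §5.2, proof of Claim 5.9, for `c_subst = 1`
(`ρ = 2`, `γ₁ = 4·5(ℓₓ+ℓ_y)`). A substring of `x` shorter than `γ₂` lives in the frame
`S = 0^{γ₂} G(xᵢ) 0^{γ₂} = 0^{γ₂} 1^{γ₁} 0^{γ₁} 1^{γ₁} 0^{γ₁} xᵢ 0^{γ₁} 1^{γ₁} 0^{γ₁} 1^{γ₁} 0^{γ₂}`, and all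
the counting in the proof of Claim 5.9 is about the function `t ↦ #1(S[0..t))`:

* `Params.frameProfile_count_take` records the value `#1(S[0..t))` on each of the eleven segments
  of `S` (exact on the constant blocks, between `2γ₁` and `2γ₁ + #1(xᵢ)` inside `xᵢ`) as an
  eleven-way disjunction (the form linear arithmetic can consume; no auxiliary definition);
* `Params.exists_anchor` ("`x(z_k)` has to contain the majority of a block `w_ℓ`"): a window
  `S[u..v)` of length `< 5γ₁/4` with `> 3γ₁/4` ones sits within `γ₁/2` of one of the four blocks
  `1^{γ₁}` of `G(xᵢ)` and takes `> 3γ₁/4` of its ones; `Params.anchor_lt_anchor` (two disjoint such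
  windows cannot share a block, and their blocks come in order) and `Params.anchors_eq` ("since the
  numbers of blocks are identical, `x(z_k)` has to contain the majority of `w_k`");
* the five estimates that make up inequality `editDist(x(G(yⱼ)), G(yⱼ)) ≥ editDist(xᵢ,yⱼ) + Δ_L(-2ρ) + Δ_R(2ρ)`
  for `c_subst = 1`, as arithmetic consequences of the profile, the anchoring, and the generic
  bounds `γ₁ ≤ editDist q 1^{γ₁} + #1(q)`, `#0(q) ≤ editDist q 1^{γ₁}`, `| |q| - γ₁ | ≤ editDist q 0^{γ₁}`
  (`Cryptography.EditDistBlocks`): `Params.dist_left_le` (`E₋₄ ≥ Δ_L(-4)`),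
  `Params.dist_mid_left_le` (`E₋₂ + E₋₁ ≥ Δ_L(0)`), `Params.dist_mid_right_le`
  (`E₁ + E₂ ≥ Δ_R(0)`), `Params.dist_right_le` (`E₄ ≥ Δ_R(4)`); with Fact 5.5(3) for the middle
  piece (`E₀ ≥ editDist(xᵢ,yⱼ) - Δ_L(0) - Δ_R(0)`) they sum to the claim. For `c_subst = 1`
  Fact 5.6 and the `s_L/s_R` bookkeeping of the printed proof are not needed: `|Δ_L - Δ_R| +
  c_subst·min{Δ_L, Δ_R} = max{Δ_L, Δ_R}`.

Positions: with `γ = γ₁`, `ℓ = ℓₓ`, the blocks of `G(xᵢ)` inside `S` start at `γ₂` (`1^γ`), `γ₂+γ`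
(`0^γ`), `γ₂+2γ`, `γ₂+3γ`, `γ₂+4γ` (`xᵢ`), `γ₂+4γ+ℓ` (`0^γ`), `γ₂+5γ+ℓ` (`1^γ`), `γ₂+6γ+ℓ`, `γ₂+7γ+ℓ`
(`1^γ`), and `G(xᵢ)` ends at `γ₂+8γ+ℓ = γ₂+γ₄`. Distances `|a - b|` are written `(a - b) + (b - a)`.
-/

namespace Literature.Computability.FineGrained

namespace BKGadget

namespace Params

variable (P : Params)

/-! ### The profile of ones of the frame -/

/-- Ones in the prefixes of the part of the frame before `xᵢ`, `0^{γ₂} 1^γ 0^γ 1^γ 0^γ`. [folklore] -/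
theorem count_true_take_frameHead (t : ℕ) :
    ((zeros P.γ₂ ++ ones P.γ₁ ++ zeros P.γ₁ ++ ones P.γ₁ ++ zeros P.γ₁).take t).count true =
      min (t - P.γ₂) P.γ₁ + min (t - P.γ₂ - P.γ₁ - P.γ₁) P.γ₁ := by
  simp only [List.append_assoc, List.take_append, List.count_append, zeros, ones,
    List.take_replicate, List.length_replicate, List.count_replicate_self, List.count_replicate]
  simp

/-- Ones in the prefixes of the part of the frame after `xᵢ`, `0^γ 1^γ 0^γ 1^γ 0^{γ₂}`. [folklore] -/
theorem count_true_take_frameTail (u : ℕ) :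
    ((zeros P.γ₁ ++ ones P.γ₁ ++ zeros P.γ₁ ++ ones P.γ₁ ++ zeros P.γ₂).take u).count true =
      min (u - P.γ₁) P.γ₁ + min (u - P.γ₁ - P.γ₁ - P.γ₁) P.γ₁ := by
  simp only [List.append_assoc, List.take_append, List.count_append, zeros, ones,
    List.take_replicate, List.length_replicate, List.count_replicate_self, List.count_replicate]
  simp

/-- **The profile of ones of the frame** `S = 0^{γ₂} G(xᵢ) 0^{γ₂}` (`xᵢ` of length `ℓₓ`): the number
`F` of ones among the first `t` symbols of `S` is `0` up to `γ₂`, grows with slope one across each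
block `1^{γ₁}` of `G(xᵢ)`, is constant across each `0^{γ₁}` and the padding, and lies between `2γ₁`
and `2γ₁ + #1(xᵢ)` inside `xᵢ` (BK15, proof of Claim 5.9, the blocks `w_{-2ρ}, …, w_{2ρ}` of
`G(xᵢ)`; one clause per segment of `S`). [cite: BringmannKunnemannFOCS2015, Claim 5.9 (proof)] -/
theorem frameProfile_count_take (xi : List Bool) (hxi : xi.length = P.ℓx) (t F : ℕ)
    (hF : ((zeros P.γ₂ ++ P.guard xi ++ zeros P.γ₂).take t).count true = F) :
    (t ≤ P.γ₂ ∧ F = 0) ∨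
    (P.γ₂ ≤ t ∧ t ≤ P.γ₂ + P.γ₁ ∧ F + P.γ₂ = t) ∨
    (P.γ₂ + P.γ₁ ≤ t ∧ t ≤ P.γ₂ + 2 * P.γ₁ ∧ F = P.γ₁) ∨
    (P.γ₂ + 2 * P.γ₁ ≤ t ∧ t ≤ P.γ₂ + 3 * P.γ₁ ∧ F + P.γ₂ + P.γ₁ = t) ∨
    (P.γ₂ + 3 * P.γ₁ ≤ t ∧ t ≤ P.γ₂ + 4 * P.γ₁ ∧ F = 2 * P.γ₁) ∨
    (P.γ₂ + 4 * P.γ₁ ≤ t ∧ t ≤ P.γ₂ + 4 * P.γ₁ + P.ℓx ∧ 2 * P.γ₁ ≤ F ∧ F ≤ 2 * P.γ₁ + xi.count true ∧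
      F + P.γ₂ + 2 * P.γ₁ ≤ t) ∨
    (P.γ₂ + 4 * P.γ₁ + P.ℓx ≤ t ∧ t ≤ P.γ₂ + 5 * P.γ₁ + P.ℓx ∧ F = 2 * P.γ₁ + xi.count true) ∨
    (P.γ₂ + 5 * P.γ₁ + P.ℓx ≤ t ∧ t ≤ P.γ₂ + 6 * P.γ₁ + P.ℓx ∧
      F + P.γ₂ + 3 * P.γ₁ + P.ℓx = t + xi.count true) ∨
    (P.γ₂ + 6 * P.γ₁ + P.ℓx ≤ t ∧ t ≤ P.γ₂ + 7 * P.γ₁ + P.ℓx ∧ F = 3 * P.γ₁ + xi.count true) ∨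
    (P.γ₂ + 7 * P.γ₁ + P.ℓx ≤ t ∧ t ≤ P.γ₂ + 8 * P.γ₁ + P.ℓx ∧
      F + P.γ₂ + 4 * P.γ₁ + P.ℓx = t + xi.count true) ∨
    (P.γ₂ + 8 * P.γ₁ + P.ℓx ≤ t ∧ F = 4 * P.γ₁ + xi.count true) := by
  have hsplit : zeros P.γ₂ ++ P.guard xi ++ zeros P.γ₂ =
      (zeros P.γ₂ ++ ones P.γ₁ ++ zeros P.γ₁ ++ ones P.γ₁ ++ zeros P.γ₁) ++ xi ++
        (zeros P.γ₁ ++ ones P.γ₁ ++ zeros P.γ₁ ++ ones P.γ₁ ++ zeros P.γ₂) := by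
    simp [guard, List.append_assoc]
  have hlenA : (zeros P.γ₂ ++ ones P.γ₁ ++ zeros P.γ₁ ++ ones P.γ₁ ++ zeros P.γ₁).length =
      P.γ₂ + 4 * P.γ₁ := by
    simp only [List.length_append, length_ones, length_zeros]; ring
  have hlenAx : (zeros P.γ₂ ++ ones P.γ₁ ++ zeros P.γ₁ ++ ones P.γ₁ ++ zeros P.γ₁ ++ xi).length =
      P.γ₂ + 4 * P.γ₁ + P.ℓx := by
    rw [List.length_append, hlenA, hxi]
  rw [hsplit, List.take_append, List.take_append, List.count_append, List.count_append,
    hlenAx, hlenA, count_true_take_frameHead, count_true_take_frameTail] at hF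
  have hc1 : (xi.take (t - (P.γ₂ + 4 * P.γ₁))).count true ≤ min (t - (P.γ₂ + 4 * P.γ₁)) P.ℓx := by
    rw [← hxi, ← List.length_take]; exact List.count_le_length
  have hc2 : (xi.take (t - (P.γ₂ + 4 * P.γ₁))).count true ≤ xi.count true :=
    (List.take_sublist _ _).count_le _
  have hc3 : P.ℓx ≤ t - (P.γ₂ + 4 * P.γ₁) →
      (xi.take (t - (P.γ₂ + 4 * P.γ₁))).count true = xi.count true := by
    intro h; rw [List.take_of_length_le (by rw [hxi]; exact h)]
  have hc0 : t ≤ P.γ₂ + 4 * P.γ₁ → (xi.take (t - (P.γ₂ + 4 * P.γ₁))).count true = 0 := by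
    intro h; rw [Nat.sub_eq_zero_of_le h, List.take_zero, List.count_nil]
  have hA4 : P.γ₂ + 4 * P.γ₁ ≤ t →
      min (t - P.γ₂) P.γ₁ + min (t - P.γ₂ - P.γ₁ - P.γ₁) P.γ₁ = 2 * P.γ₁ := by
    intro h; omega
  have hB0 : t ≤ P.γ₂ + 4 * P.γ₁ + P.ℓx →
      min (t - (P.γ₂ + 4 * P.γ₁ + P.ℓx) - P.γ₁) P.γ₁ +
        min (t - (P.γ₂ + 4 * P.γ₁ + P.ℓx) - P.γ₁ - P.γ₁ - P.γ₁) P.γ₁ = 0 := by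
    intro h; omega
  by_cases r5 : t ≤ P.γ₂ + 4 * P.γ₁
  · -- before `xᵢ`: no ones from `xᵢ` or from the tail
    rw [hc0 r5, hB0 (by omega)] at hF
    clear hc0 hc1 hc2 hc3 hA4 hB0
    by_cases r1 : t ≤ P.γ₂
    · exact Or.inl ⟨r1, by omega⟩
    by_cases r2 : t ≤ P.γ₂ + P.γ₁
    · exact Or.inr (Or.inl ⟨by omega, r2, by omega⟩)
    by_cases r3 : t ≤ P.γ₂ + 2 * P.γ₁
    · exact Or.inr (Or.inr (Or.inl ⟨by omega, r3, by omega⟩))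
    by_cases r4 : t ≤ P.γ₂ + 3 * P.γ₁
    · exact Or.inr (Or.inr (Or.inr (Or.inl ⟨by omega, r4, by omega⟩)))
    exact Or.inr (Or.inr (Or.inr (Or.inr (Or.inl ⟨by omega, r5, by omega⟩))))
  · push Not at r5
    rw [hA4 r5.le] at hF
    by_cases r6 : t ≤ P.γ₂ + 4 * P.γ₁ + P.ℓx
    · -- inside `xᵢ`
      rw [hB0 r6] at hF
      clear hc0 hc3 hA4 hB0
      exact Or.inr (Or.inr (Or.inr (Or.inr (Or.inr (Or.inl ⟨r5.le, r6, by omega, by omega, by omega⟩)))))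
    · push Not at r6
      rw [hc3 (by omega)] at hF
      clear hc0 hc1 hc2 hc3 hA4 hB0
      by_cases r7 : t ≤ P.γ₂ + 5 * P.γ₁ + P.ℓx
      · exact Or.inr (Or.inr (Or.inr (Or.inr (Or.inr (Or.inr (Or.inl ⟨r6.le, r7, by omega⟩))))))
      by_cases r8 : t ≤ P.γ₂ + 6 * P.γ₁ + P.ℓx
      · exact Or.inr (Or.inr (Or.inr (Or.inr (Or.inr (Or.inr (Or.inr (Or.inl ⟨by omega, r8, by omega⟩)))))))
      by_cases r9 : t ≤ P.γ₂ + 7 * P.γ₁ + P.ℓx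
      · exact Or.inr (Or.inr (Or.inr (Or.inr (Or.inr (Or.inr (Or.inr (Or.inr
          (Or.inl ⟨by omega, r9, by omega⟩))))))))
      by_cases r10 : t ≤ P.γ₂ + 8 * P.γ₁ + P.ℓx
      · exact Or.inr (Or.inr (Or.inr (Or.inr (Or.inr (Or.inr (Or.inr (Or.inr (Or.inr
          (Or.inl ⟨by omega, r10, by omega⟩)))))))))
      exact Or.inr (Or.inr (Or.inr (Or.inr (Or.inr (Or.inr (Or.inr (Or.inr (Or.inr (Or.inr
          ⟨by omega, by omega⟩)))))))))

/-! ### Anchoring of short windows with many ones -/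

/-- **Anchoring** (BK15, proof of Claim 5.9: "`x(z_k)` has to contain the majority of a block
`w_ℓ`"): a window `S[u..v)` of the frame of length `< 5γ₁/4` containing `> 3γ₁/4` ones lies within
`γ₁/2` of one of the four blocks `1^{γ₁}` of `G(xᵢ)` (which start at
`B ∈ {γ₂, γ₂+2γ₁, γ₂+5γ₁+ℓₓ, γ₂+7γ₁+ℓₓ}`) and overlaps it in `> 3γ₁/4` positions. Here
`γ₁/4 = 5(ℓₓ+ℓ_y)`. [cite: BringmannKunnemannFOCS2015, Claim 5.9 (proof)] -/
theorem exists_anchor (xi : List Bool) (hxi : xi.length = P.ℓx) {u v : ℕ} (huv : u ≤ v)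
    (hlen : v < u + 5 * (5 * (P.ℓx + P.ℓy)))
    (hones : (((zeros P.γ₂ ++ P.guard xi ++ zeros P.γ₂).take u).count true) + 3 * (5 * (P.ℓx + P.ℓy)) <
      (((zeros P.γ₂ ++ P.guard xi ++ zeros P.γ₂).take v).count true)) :
    ∃ B, (B = P.γ₂ ∨ B = P.γ₂ + 2 * P.γ₁ ∨ B = P.γ₂ + 5 * P.γ₁ + P.ℓx ∨ B = P.γ₂ + 7 * P.γ₁ + P.ℓx) ∧
      B ≤ u + 10 * (P.ℓx + P.ℓy) ∧ u ≤ B + 10 * (P.ℓx + P.ℓy) ∧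
      B + P.γ₁ ≤ v + 10 * (P.ℓx + P.ℓy) ∧ v ≤ B + P.γ₁ + 10 * (P.ℓx + P.ℓy) ∧
      3 * (5 * (P.ℓx + P.ℓy)) + 1 + max u B ≤ min v (B + P.γ₁) := by
  have hγ : P.γ₁ = 20 * (P.ℓx + P.ℓy) := rfl
  have hsx : xi.count true ≤ P.ℓx := hxi ▸ List.count_le_length
  have hu := P.frameProfile_count_take xi hxi u _ rfl
  have hv := P.frameProfile_count_take xi hxi v _ rfl
  by_cases h1 : v ≤ P.γ₂ + 2 * P.γ₁
  · exact ⟨P.γ₂, Or.inl rfl, by omega, by omega, by omega, by omega, by omega⟩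
  · by_cases h2 : v ≤ P.γ₂ + 4 * P.γ₁ + P.ℓx
    · exact ⟨P.γ₂ + 2 * P.γ₁, Or.inr (Or.inl rfl), by omega, by omega, by omega, by omega, by omega⟩
    · by_cases h3 : v ≤ P.γ₂ + 7 * P.γ₁ + P.ℓx
      · exact ⟨P.γ₂ + 5 * P.γ₁ + P.ℓx, Or.inr (Or.inr (Or.inl rfl)), by omega, by omega, by omega,
          by omega, by omega⟩
      · exact ⟨P.γ₂ + 7 * P.γ₁ + P.ℓx, Or.inr (Or.inr (Or.inr rfl)), by omega, by omega, by omega,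
          by omega, by omega⟩

/-- Two windows overlapping blocks `1^{γ₁}` in `> 3γ₁/4` positions each, as in `exists_anchor`, the
first ending before the second starts, are anchored at increasing positions (BK15, proof of
Claim 5.9: each contains the majority of its block). [cite: BringmannKunnemannFOCS2015, Claim 5.9 (proof)] -/
theorem anchor_lt_anchor {u v u' v' B B' : ℕ}
    (ho : 3 * (5 * (P.ℓx + P.ℓy)) + 1 + max u B ≤ min v (B + P.γ₁))
    (ho' : 3 * (5 * (P.ℓx + P.ℓy)) + 1 + max u' B' ≤ min v' (B' + P.γ₁)) (hvu : v ≤ u') :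
    B < B' := by
  have hγ : P.γ₁ = 20 * (P.ℓx + P.ℓy) := rfl
  omega

/-- "Since the numbers of blocks are identical, `x(z_k)` has to contain the majority of `w_k`":
four anchors in increasing order are the four blocks in order. [cite: BringmannKunnemannFOCS2015, Claim 5.9 (proof)] -/
theorem anchors_eq {B₀ B₂ B₆ B₈ : ℕ}
    (h₀ : B₀ = P.γ₂ ∨ B₀ = P.γ₂ + 2 * P.γ₁ ∨ B₀ = P.γ₂ + 5 * P.γ₁ + P.ℓx ∨ B₀ = P.γ₂ + 7 * P.γ₁ + P.ℓx)
    (h₂ : B₂ = P.γ₂ ∨ B₂ = P.γ₂ + 2 * P.γ₁ ∨ B₂ = P.γ₂ + 5 * P.γ₁ + P.ℓx ∨ B₂ = P.γ₂ + 7 * P.γ₁ + P.ℓx)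
    (h₆ : B₆ = P.γ₂ ∨ B₆ = P.γ₂ + 2 * P.γ₁ ∨ B₆ = P.γ₂ + 5 * P.γ₁ + P.ℓx ∨ B₆ = P.γ₂ + 7 * P.γ₁ + P.ℓx)
    (h₈ : B₈ = P.γ₂ ∨ B₈ = P.γ₂ + 2 * P.γ₁ ∨ B₈ = P.γ₂ + 5 * P.γ₁ + P.ℓx ∨ B₈ = P.γ₂ + 7 * P.γ₁ + P.ℓx)
    (h02 : B₀ < B₂) (h26 : B₂ < B₆) (h68 : B₆ < B₈) :
    B₀ = P.γ₂ ∧ B₂ = P.γ₂ + 2 * P.γ₁ ∧ B₆ = P.γ₂ + 5 * P.γ₁ + P.ℓx ∧ B₈ = P.γ₂ + 7 * P.γ₁ + P.ℓx := by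
  omega

/-! ### The five estimates of Claim 5.9 for `c_subst = 1` -/

/-- `E₋₄ ≥ Δ_L(-4)`: the piece facing the first block `1^{γ₁}` of `G(yⱼ)`, anchored at the first
block `1^{γ₁}` of `G(xᵢ)` (start `γ₂`), pays for its misalignment at the left end: if it starts
early it contains that many zeros of the padding (`#0(q) ≤ E`), if it starts late it misses that
many ones (`γ₁ ≤ E + #1(q)`). [cite: BringmannKunnemannFOCS2015, Claim 5.9 (proof)] -/
theorem dist_left_le (xi : List Bool) (hxi : xi.length = P.ℓx) {T₀ T₁ E : ℕ} (hT : T₀ ≤ T₁)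
    (ha₀ : T₀ ≤ P.γ₂ + 10 * (P.ℓx + P.ℓy) ∧ P.γ₂ ≤ T₀ + 10 * (P.ℓx + P.ℓy))
    (ha₁ : T₁ ≤ P.γ₂ + P.γ₁ + 10 * (P.ℓx + P.ℓy) ∧ P.γ₂ + P.γ₁ ≤ T₁ + 10 * (P.ℓx + P.ℓy))
    (hE₁ : P.γ₁ ≤ E + ((((zeros P.γ₂ ++ P.guard xi ++ zeros P.γ₂).take T₁).count true) -
      (((zeros P.γ₂ ++ P.guard xi ++ zeros P.γ₂).take T₀).count true)))
    (hE₂ : T₁ - T₀ ≤ E + ((((zeros P.γ₂ ++ P.guard xi ++ zeros P.γ₂).take T₁).count true) -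
      (((zeros P.γ₂ ++ P.guard xi ++ zeros P.γ₂).take T₀).count true))) :
    (T₀ - P.γ₂) + (P.γ₂ - T₀) ≤ E := by
  have hγ : P.γ₁ = 20 * (P.ℓx + P.ℓy) := rfl
  have hsx : xi.count true ≤ P.ℓx := hxi ▸ List.count_le_length
  have h₀ := P.frameProfile_count_take xi hxi T₀ _ rfl
  have h₁ := P.frameProfile_count_take xi hxi T₁ _ rfl
  omega

/-- `E₋₂ + E₋₁ ≥ Δ_L(0)`: the piece facing the second block `1^{γ₁}` of `G(yⱼ)`, anchored at the
second block `1^{γ₁}` of `G(xᵢ)` (ending at `γ₂+3γ₁`), pays for its misalignment `Δ_R(-2)` at the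
right end, and the piece facing `z₋₁ = 0^{γ₁}` pays `| |q| - γ₁ | ≥ Δ_L(0) - Δ_R(-2)`, where `Δ_L(0)` is
the distance of its right end `T₄` from the start `γ₂+4γ₁` of `xᵢ`. [cite: BringmannKunnemannFOCS2015, Claim 5.9 (proof)] -/
theorem dist_mid_left_le (xi : List Bool) (hxi : xi.length = P.ℓx) {T₂ T₃ T₄ E₂ E₃ : ℕ}
    (hT : T₂ ≤ T₃) (hT' : T₃ ≤ T₄)
    (ha₂ : T₂ ≤ P.γ₂ + 2 * P.γ₁ + 10 * (P.ℓx + P.ℓy) ∧ P.γ₂ + 2 * P.γ₁ ≤ T₂ + 10 * (P.ℓx + P.ℓy))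
    (ha₃ : T₃ ≤ P.γ₂ + 3 * P.γ₁ + 10 * (P.ℓx + P.ℓy) ∧ P.γ₂ + 3 * P.γ₁ ≤ T₃ + 10 * (P.ℓx + P.ℓy))
    (hE₂ : P.γ₁ ≤ E₂ + ((((zeros P.γ₂ ++ P.guard xi ++ zeros P.γ₂).take T₃).count true) -
      (((zeros P.γ₂ ++ P.guard xi ++ zeros P.γ₂).take T₂).count true)))
    (hE₂' : T₃ - T₂ ≤ E₂ + ((((zeros P.γ₂ ++ P.guard xi ++ zeros P.γ₂).take T₃).count true) -
      (((zeros P.γ₂ ++ P.guard xi ++ zeros P.γ₂).take T₂).count true)))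
    (hE₃ : T₄ - T₃ ≤ E₃ + P.γ₁) (hE₃' : P.γ₁ ≤ E₃ + (T₄ - T₃)) :
    (T₄ - (P.γ₂ + 4 * P.γ₁)) + (P.γ₂ + 4 * P.γ₁ - T₄) ≤ E₂ + E₃ := by
  have hγ : P.γ₁ = 20 * (P.ℓx + P.ℓy) := rfl
  have hsx : xi.count true ≤ P.ℓx := hxi ▸ List.count_le_length
  have h₂ := P.frameProfile_count_take xi hxi T₂ _ rfl
  have h₃ := P.frameProfile_count_take xi hxi T₃ _ rfl
  omega

/-- `E₁ + E₂ ≥ Δ_R(0)`: symmetrically, the piece facing the third block `1^{γ₁}` of `G(yⱼ)`,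
anchored at the third block `1^{γ₁}` of `G(xᵢ)` (start `γ₂+5γ₁+ℓₓ`), pays for its misalignment at
the left end, and the piece facing `z₁ = 0^{γ₁}` pays the rest of `Δ_R(0)`, the distance of its
left end `T₅` from the end `γ₂+4γ₁+ℓₓ` of `xᵢ`. [cite: BringmannKunnemannFOCS2015, Claim 5.9 (proof)] -/
theorem dist_mid_right_le (xi : List Bool) (hxi : xi.length = P.ℓx) {T₅ T₆ T₇ E₅ E₆ : ℕ}
    (hT : T₅ ≤ T₆) (hT' : T₆ ≤ T₇)
    (ha₆ : T₆ ≤ P.γ₂ + 5 * P.γ₁ + P.ℓx + 10 * (P.ℓx + P.ℓy) ∧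
      P.γ₂ + 5 * P.γ₁ + P.ℓx ≤ T₆ + 10 * (P.ℓx + P.ℓy))
    (ha₇ : T₇ ≤ P.γ₂ + 6 * P.γ₁ + P.ℓx + 10 * (P.ℓx + P.ℓy) ∧
      P.γ₂ + 6 * P.γ₁ + P.ℓx ≤ T₇ + 10 * (P.ℓx + P.ℓy))
    (hE₆ : P.γ₁ ≤ E₆ + ((((zeros P.γ₂ ++ P.guard xi ++ zeros P.γ₂).take T₇).count true) -
      (((zeros P.γ₂ ++ P.guard xi ++ zeros P.γ₂).take T₆).count true)))
    (hE₆' : T₇ - T₆ ≤ E₆ + ((((zeros P.γ₂ ++ P.guard xi ++ zeros P.γ₂).take T₇).count true) -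
      (((zeros P.γ₂ ++ P.guard xi ++ zeros P.γ₂).take T₆).count true)))
    (hE₅ : T₆ - T₅ ≤ E₅ + P.γ₁) (hE₅' : P.γ₁ ≤ E₅ + (T₆ - T₅)) :
    (T₅ - (P.γ₂ + 4 * P.γ₁ + P.ℓx)) + (P.γ₂ + 4 * P.γ₁ + P.ℓx - T₅) ≤ E₅ + E₆ := by
  have hγ : P.γ₁ = 20 * (P.ℓx + P.ℓy) := rfl
  have hsx : xi.count true ≤ P.ℓx := hxi ▸ List.count_le_length
  have h₆ := P.frameProfile_count_take xi hxi T₆ _ rfl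
  have h₇ := P.frameProfile_count_take xi hxi T₇ _ rfl
  omega

/-- `E₄ ≥ Δ_R(4)`: the piece facing the last block `1^{γ₁}` of `G(yⱼ)`, anchored at the last block
`1^{γ₁}` of `G(xᵢ)` (ending at `γ₂+8γ₁+ℓₓ = γ₂+γ₄`), pays for its misalignment at the right end.
[cite: BringmannKunnemannFOCS2015, Claim 5.9 (proof)] -/
theorem dist_right_le (xi : List Bool) (hxi : xi.length = P.ℓx) {T₈ T₉ E : ℕ} (hT : T₈ ≤ T₉)
    (ha₈ : T₈ ≤ P.γ₂ + 7 * P.γ₁ + P.ℓx + 10 * (P.ℓx + P.ℓy) ∧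
      P.γ₂ + 7 * P.γ₁ + P.ℓx ≤ T₈ + 10 * (P.ℓx + P.ℓy))
    (ha₉ : T₉ ≤ P.γ₂ + 8 * P.γ₁ + P.ℓx + 10 * (P.ℓx + P.ℓy) ∧
      P.γ₂ + 8 * P.γ₁ + P.ℓx ≤ T₉ + 10 * (P.ℓx + P.ℓy))
    (hE₁ : P.γ₁ ≤ E + ((((zeros P.γ₂ ++ P.guard xi ++ zeros P.γ₂).take T₉).count true) -
      (((zeros P.γ₂ ++ P.guard xi ++ zeros P.γ₂).take T₈).count true)))
    (hE₂ : T₉ - T₈ ≤ E + ((((zeros P.γ₂ ++ P.guard xi ++ zeros P.γ₂).take T₉).count true) -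
      (((zeros P.γ₂ ++ P.guard xi ++ zeros P.γ₂).take T₈).count true))) :
    (T₉ - (P.γ₂ + 8 * P.γ₁ + P.ℓx)) + (P.γ₂ + 8 * P.γ₁ + P.ℓx - T₉) ≤ E := by
  have hγ : P.γ₁ = 20 * (P.ℓx + P.ℓy) := rfl
  have hsx : xi.count true ≤ P.ℓx := hxi ▸ List.count_le_length
  have h₈ := P.frameProfile_count_take xi hxi T₈ _ rfl
  have h₉ := P.frameProfile_count_take xi hxi T₉ _ rfl
  omega

end Params

end BKGadget

end Literature.Computability.FineGrained
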